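import Summits.HodgeConjecture.CorCM.MumfordTateRankFourCM
import Summits.HodgeConjecture.CorCM.MumfordTateRankFourDivisorClasses
import Summits.HodgeConjecture.CorCM.MumfordTateRankThree
import Summits.HodgeConjecture.CorCM.SexticCMThreefoldCurvePowersHodgeOfMarkman
import Literature.AlgebraicGeometry.Pohlmann1968.SimpleCMAbelianFourfoldHodgeConjecture
import HarnessLib

/-!
# Every complex abelian variety with `dim MT(H¹(X)) ≤ 4` satisfies the Hodge conjecture together with all its powers,
# given only Markman's fourfold theorem — unconditionally outside two CM shapes

COR-CM (cell `pub-hodgecm2`, seat `b27` gen 32, count-neutral lane MT-RANK-FOUR-CM, file 3; theorems only, no definition,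
no named fact).  NEW as stated (an assembly of tree theorems), hence under `Summits/`.  HONEST FRAMING: the Hodge
conjecture is asserted ONLY for complex abelian varieties `X` with `dim MT(H¹(X)) ≤ 4` and their powers, and in the two
degenerate CM shapes ONLY conditionally on the named fact `HodgeTheory.Markman2025_weilClasses_algebraic_abelianFourfold`
(Markman 2025: the Weil classes of abelian fourfolds of Weil type are algebraic), which enters as an explicit hypothesis
of every `_of_markman` theorem; `HC_CM` is neither used nor asserted.

The rung `dim MT(H¹(X)) ≤ 4` of the Mumford–Tate ladder of this seat, assembled:
* `dim MT(H¹(X)) ≤ 3` ⟹ `X` is of CM type and stably nondegenerate (gens 28–29, `CorCM/MumfordTateRankAtMostThree`,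
  `CorCM/MumfordTateRankThree`);
* `dim MT(H¹(X)) = 4`, `X` NOT of CM type ⟹ stably nondegenerate (gens 30–31, `CorCM/MumfordTateRankFourDivisorClasses`:
  all powers of non-CM elliptic curves and of QM abelian surfaces);
* `dim MT(H¹(X)) = 4`, `X` of CM type ⟹ stably nondegenerate, OR `X ∼ ⨁ A` (`A` a simple CM fourfold of Weil type), OR
  `X ∼ ⨁_j ![E, T] (κ j)` (`T` a simple CM threefold of the sextic field `K`, `E` a CM elliptic curve of `k ↪ K`) — gen 32,
  `CorCM/MumfordTateRankFourCM`.
In the two degenerate shapes the tree has the Hodge conjecture for all powers GIVEN Markman's theorem: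
`Pohlmann1968.hodgeConjectureFor_of_isIsogenous_powSucc_of_dim_four_of_markman` (simple CM fourfolds, both branches of
Gordon 5.13) and seat b30's `SexticCMThreefold.hodgeConjectureFor_powSucc_of_isIsogenous_biproduct_comp_of_markman`
(`E^c × T^a`, any sextic `K ⊇ k`).  Hence:

* `forall_powSucc_or_shape_of_mtRank_hodge_one_le_four` — UNCONDITIONAL TRICHOTOMY for every complex abelian variety `X`
  with `0 < dim X` and `dim MT(H¹(X)) ≤ 4`: every power `X^{N+1}` is divisor-generated AND satisfies the Hodge conjecture,
  OR `X` is of CM type of one of the two degenerate shapes.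
* `hodgeConjectureFor_powSucc_of_isOfCMType_of_mtRank_hodge_one_le_four_of_markman` (CM case) and
  **`hodgeConjectureFor_powSucc_of_mtRank_hodge_one_le_four_of_markman`** — **for EVERY complex abelian variety `X` with
  `0 < dim X` and `dim MT(H¹(X)) ≤ 4`, every power `X^{N+1}` satisfies the Hodge conjecture, GIVEN ONLY
  `Markman2025_weilClasses_algebraic_abelianFourfold`**; `…_of_isIsogenous_powSucc_…` (isogeny classes of the powers);
  instance-free form and the class-target display `hcOnClass_mtRank_hodge_one_le_four_of_markman`.

(`dim MT(H¹(X)) = 5` is the first rank where the method meets open cases beyond Markman's theorem: e.g. a simple CM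
SIXFOLD of corank one — Weil classes in `H⁶` — or `E × F` with `F` a simple CM fourfold of Weil type for `k_E`.)

## References

* [MoonenZarhin1999LowDim] B. Moonen, Yu. Zarhin, *Hodge classes on abelian varieties of low dimension*, Math. Ann.
  315 (1999) 711–733, Thms. (0.1)–(0.2).
* [Markman2025SurveySecant] E. Markman, *Secant sheaves and Weil classes on abelian varieties*, arXiv:2509.23403, Thm. 1.2,
  §11.5 Step 2; [Markman2025SecantWeil] arXiv:2502.03415, Cor. 1.6.1.
* [Gordon1999HodgeAVSurvey] B. B. Gordon, *A survey of the Hodge conjecture for abelian varieties*, 5.13, 7.5–7.7, 9.4,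
  §10.12.2.
* [Andre1992HodgeCM] Y. André, *Une remarque à propos des cycles de Hodge de type CM*, Progr. Math. 102 (1992).
-/

noncomputable section

open CategoryTheory CategoryTheory.Limits NumberField Module
open scoped BigOperators

namespace Summit.HodgeConjecture.CorCM

open Literature.NumberTheory.ComplexMultiplication
open Literature.AlgebraicGeometry.Motives
open Literature.AlgebraicGeometry.Motives.AbelianVariety
open Literature.AlgebraicGeometry.HodgeTheory
open Literature.AlgebraicGeometry.ComplexMultiplication (IsCMTypeRealisation)
open Literature.AlgebraicGeometry.Milne1999 (IsOfCMType)
open Literature.AlgebraicGeometry.Pohlmann1968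

/-! ## §1 The unconditional trichotomy at `dim MT(H¹(X)) ≤ 4` -/

section Trichotomy

variable [HodgeTensorFacts.{0, 0}] {X : AbelianVariety ℂ} {n : ℕ} (hX : IsSmoothProjective n X.X)

/-- **Trichotomy at Mumford–Tate rank `≤ 4` (UNCONDITIONAL).**  For every complex abelian variety `X` with `0 < dim X`
and `dim MT(H¹(X)) ≤ 4`: EITHER every power `X^{N+1}` is divisor-generated (`B• = D• ⊗ ℂ`) and satisfies the Hodge
conjecture; OR `X` is of CM type with `dim MT(H¹(X)) = 4` and `X ∼ ⨁_{Fin (m+1)} A` for a SIMPLE CM abelian FOURFOLD `A`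
with `dim MT(H¹(A)) = 4`, `B(A) ≠ D(A)` (Weil type); OR `X` is of CM type with `dim MT(H¹(X)) = 4` and
`X ∼ ⨁_j ![E, T] (κ j)` (`κ` onto `Fin 2`) with `T ⊨ (K; Φ)` a SIMPLE CM threefold (`[K:ℚ] = 6`), `E ⊨ (k; Ψ)` a CM
elliptic curve (`[k:ℚ] = 2`) and `i : k →+* K`.  (Non-CM: gens 30–31; CM with `dim MT ≤ 3`: gen 28; CM with
`dim MT = 4`: `shape_of_mtRank_hodge_one_eq_four_of_not_forall_isDivisorGenerated`.)
[cite: MoonenZarhin1999LowDim, Thm. (0.1) and Thm. (0.2)] [cite: Gordon1999HodgeAVSurvey, 5.13, 7.5 and §7.3.2] -/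
theorem forall_powSucc_or_shape_of_mtRank_hodge_one_le_four (h0 : 0 < X.dim)
    (h4 : haveI := BettiUniverse.finite hX 1
      (BettiUniverse.hodge exists_isReal_hodgeModel_holds hX 1).mtRank ≤ 4) :
    (∀ N : ℕ, IsDivisorGenerated (X.powSucc N) ∧ HodgeConjectureFor (X.powSucc N).dim (X.powSucc N).X) ∨
    (IsOfCMType X ∧ (haveI := BettiUniverse.finite hX 1
        (BettiUniverse.hodge exists_isReal_hodgeModel_holds hX 1).mtRank = 4) ∧
      ∃ (A : AbelianVariety ℂ) (m : ℕ), A.IsSimple ∧ A.dim = 4 ∧ IsOfCMType A ∧ ¬ IsDivisorGenerated A ∧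
        @HodgeStructure.mtRank _ _ _ ‹HodgeTensorFacts.{0, 0}›
            (BettiUniverse.finite (AbelianVariety.isSmoothProjective_holds (A := A)) 1) _
            (BettiUniverse.hodge exists_isReal_hodgeModel_holds (AbelianVariety.isSmoothProjective_holds (A := A)) 1) = 4 ∧
        IsIsogenous X (⨁ fun _ : Fin (m + 1) => A)) ∨
    (IsOfCMType X ∧ (haveI := BettiUniverse.finite hX 1
        (BettiUniverse.hodge exists_isReal_hodgeModel_holds hX 1).mtRank = 4) ∧
      ∃ (K k : Type) (_ : Field K) (_ : NumberField K) (_ : IsCMField K) (_ : Field k) (_ : NumberField k)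
        (_ : IsCMField k) (Φ : CMType K) (Ψ : CMType k) (T E : AbelianVariety ℂ) (ιT : 𝓞 K →+* End T)
        (θT : K →+* Module.End ℂ (complexBetti T.X 1)) (ιE : 𝓞 k →+* End E)
        (θE : k →+* Module.End ℂ (complexBetti E.X 1)) (_ : k →+* K) (m : ℕ) (κ : Fin (m + 1) → Fin 2),
        finrank ℚ K = 6 ∧ finrank ℚ k = 2 ∧ IsCMTypeRealisation Φ T ιT θT ∧ T.IsSimple ∧ T.dim = 3 ∧
          IsCMTypeRealisation Ψ E ιE θE ∧ E.dim = 1 ∧ ¬ IsIsogenous E T ∧ Function.Surjective κ ∧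
          IsIsogenous X (⨁ fun j => (![E, T] : Fin 2 → AbelianVariety ℂ) (κ j))) := by
  haveI := BettiUniverse.finite hX 1
  by_cases hcm : IsOfCMType X
  · by_cases hDG : ∀ N : ℕ, IsDivisorGenerated (X.powSucc N)
    · exact Or.inl fun N => ⟨hDG N, hodgeConjectureFor_of_isDivisorGenerated _ (hDG N)⟩
    · have h4' : (BettiUniverse.hodge exists_isReal_hodgeModel_holds hX 1).mtRank = 4 := by
        by_contra hne
        exact hDG (forall_isDivisorGenerated_powSucc_of_mtRank_hodge_one_le_three hX h0 hcm (by omega))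
      rcases shape_of_mtRank_hodge_one_eq_four_of_not_forall_isDivisorGenerated hX h0 hcm h4' hDG with hD1 | hD2
      · exact Or.inr (Or.inl ⟨hcm, h4', hD1⟩)
      · exact Or.inr (Or.inr ⟨hcm, h4', hD2⟩)
  · exact Or.inl fun N =>
      isDivisorGenerated_and_hodgeConjectureFor_powSucc_of_not_isOfCMType_of_mtRank_le_four hX h0 hcm h4 N

end Trichotomy

/-! ## §2 The Hodge conjecture for all powers, given Markman's fourfold theorem -/

section Markman

variable [HodgeTensorFacts.{0, 0}] {X : AbelianVariety ℂ} {n : ℕ} (hX : IsSmoothProjective n X.X)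

/-- **CM case.**  For a complex abelian variety `X` of CM type with `0 < dim X` and `dim MT(H¹(X)) ≤ 4`, every power
`X^{N+1}` satisfies the Hodge conjecture, GIVEN Markman's fourfold theorem — unconditionally unless `X` has one of the
two degenerate shapes; there: powers of a simple CM fourfold (Gordon 5.13 both branches, §10.12.2 Abdulali; tree
`hodgeConjectureFor_of_isIsogenous_powSucc_of_dim_four_of_markman`) and `E^c × T^a` with `k ↪ K` (seat b30's
`SexticCMThreefold.hodgeConjectureFor_powSucc_of_isIsogenous_biproduct_comp_of_markman`, André's motivated reduction to
Weil classes of fourfolds).  [cite: Markman2025SurveySecant, Thm. 1.2 and §11.5 Step 2]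
[cite: Gordon1999HodgeAVSurvey, 5.13 and §10.12.2] [cite: MoonenZarhin1999LowDim, Thm. (0.1) and (0.2) (a)]
[cite: Andre1992HodgeCM, Théorème] -/
theorem hodgeConjectureFor_powSucc_of_isOfCMType_of_mtRank_hodge_one_le_four_of_markman
    (hW4 : Markman2025_weilClasses_algebraic_abelianFourfold) (h0 : 0 < X.dim) (hcm : IsOfCMType X)
    (h4 : haveI := BettiUniverse.finite hX 1
      (BettiUniverse.hodge exists_isReal_hodgeModel_holds hX 1).mtRank ≤ 4) (N : ℕ) :
    HodgeConjectureFor (X.powSucc N).dim (X.powSucc N).X := by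
  classical
  haveI := BettiUniverse.finite hX 1
  by_cases hDG : ∀ N : ℕ, IsDivisorGenerated (X.powSucc N)
  · exact hodgeConjectureFor_of_isDivisorGenerated _ (hDG N)
  have h4' : (BettiUniverse.hodge exists_isReal_hodgeModel_holds hX 1).mtRank = 4 := by
    by_contra hne
    exact hDG (forall_isDivisorGenerated_powSucc_of_mtRank_hodge_one_le_three hX h0 hcm (by omega))
  rcases shape_of_mtRank_hodge_one_eq_four_of_not_forall_isDivisorGenerated hX h0 hcm h4' hDG with
    ⟨A, m, hs, hA4, hcmA, -, -, hXB⟩ |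
    ⟨K, k, _, _, _, _, _, _, Φ, Ψ, T, E, ιT, θT, ιE, θE, i, m, κ, h6, h2, hT, hTs, -, hE, -, -, -, hXB⟩
  · -- powers of a simple CM fourfold: `X^{N+1}` is an isogeny factor of some `⨁_{Fin k} A`
    obtain ⟨k, ρ, hdom⟩ := exists_avDominatedBy_powSucc_biproduct_slots_of_isIsogenous (A' := fun _ : Unit => A)
      (cls := fun _ : Fin (m + 1) => ()) hXB N
    rcases k with _ | k
    · exact Domination.hodgeConjectureFor_of_avDominatedBy
        (hodgeConjectureFor_of_isDivisorGenerated _ (isDivisorGenerated_of_dim_eq_zero _ (dim_biproduct_fin_zero _))) hdom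
    · exact Domination.hodgeConjectureFor_of_avDominatedBy
        (hodgeConjectureFor_of_isIsogenous_powSucc_of_dim_four_of_markman hW4 hs hA4 hcmA
          (isIsogenous_powSucc_biproduct A k).symm') hdom
  · -- `E^c × T^a` with `k ↪ K`
    exact SexticCMThreefold.hodgeConjectureFor_powSucc_of_isIsogenous_biproduct_comp_of_markman hW4 h6 h2 i hE hT hTs κ
      hXB N

/-- **The Hodge conjecture for every power of every complex abelian variety `X` with `0 < dim X` and
`dim MT(H¹(X)) ≤ 4`, GIVEN ONLY Markman's fourfold theorem** (`Markman2025_weilClasses_algebraic_abelianFourfold`); the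
dependence on Markman is confined to the two degenerate CM shapes of `forall_powSucc_or_shape_of_mtRank_hodge_one_le_four`.
[cite: Markman2025SurveySecant, Thm. 1.2] [cite: MoonenZarhin1999LowDim, Thms. (0.1)–(0.2)]
[cite: Gordon1999HodgeAVSurvey, 5.13, 7.5 and §7.3.2] -/
theorem hodgeConjectureFor_powSucc_of_mtRank_hodge_one_le_four_of_markman
    (hW4 : Markman2025_weilClasses_algebraic_abelianFourfold) (h0 : 0 < X.dim)
    (h4 : haveI := BettiUniverse.finite hX 1
      (BettiUniverse.hodge exists_isReal_hodgeModel_holds hX 1).mtRank ≤ 4) (N : ℕ) :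
    HodgeConjectureFor (X.powSucc N).dim (X.powSucc N).X := by
  by_cases hcm : IsOfCMType X
  · exact hodgeConjectureFor_powSucc_of_isOfCMType_of_mtRank_hodge_one_le_four_of_markman hX hW4 h0 hcm h4 N
  · exact (isDivisorGenerated_and_hodgeConjectureFor_powSucc_of_not_isOfCMType_of_mtRank_le_four hX h0 hcm h4 N).2

/-- **The variety itself** (`N = 0`): every complex abelian variety with `0 < dim X` and `dim MT(H¹(X)) ≤ 4` satisfies
the Hodge conjecture, given Markman's fourfold theorem. [cite: Markman2025SurveySecant, Thm. 1.2]
[cite: MoonenZarhin1999LowDim, Thms. (0.1)–(0.2)] -/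
theorem hodgeConjectureFor_of_mtRank_hodge_one_le_four_of_markman
    (hW4 : Markman2025_weilClasses_algebraic_abelianFourfold) (h0 : 0 < X.dim)
    (h4 : haveI := BettiUniverse.finite hX 1
      (BettiUniverse.hodge exists_isReal_hodgeModel_holds hX 1).mtRank ≤ 4) :
    HodgeConjectureFor X.dim X.X :=
  hodgeConjectureFor_powSucc_of_mtRank_hodge_one_le_four_of_markman hX hW4 h0 h4 0

/-- **Isogeny classes of the powers**: every complex abelian variety isogenous to a power `X^{N+1}` of some `X` with
`0 < dim X` and `dim MT(H¹(X)) ≤ 4` satisfies the Hodge conjecture, given Markman's fourfold theorem (van Geemen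
Lemma 3.7). [cite: vanGeemen1994HodgeAV, §3.6–3.7 Lemma 3.7] [cite: Markman2025SurveySecant, Thm. 1.2] -/
theorem hodgeConjectureFor_of_isIsogenous_powSucc_of_mtRank_hodge_one_le_four_of_markman
    (hW4 : Markman2025_weilClasses_algebraic_abelianFourfold) (h0 : 0 < X.dim)
    (h4 : haveI := BettiUniverse.finite hX 1
      (BettiUniverse.hodge exists_isReal_hodgeModel_holds hX 1).mtRank ≤ 4)
    {B : AbelianVariety ℂ} {N : ℕ} (hB : IsIsogenous B (X.powSucc N)) : HodgeConjectureFor B.dim B.X :=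
  HodgeConjectureFor.of_isIsogenous hB (hodgeConjectureFor_powSucc_of_mtRank_hodge_one_le_four_of_markman hX hW4 h0 h4 N)

end Markman

/-! ## §3 Instance-free form and class-target display -/

section InstanceFree

/-- Instance-free form (the tensor facts discharged by `hodgeTensorFacts_holds`): **`dim MT(H¹(X)) ≤ 4` ⟹ every power of
`X` satisfies the Hodge conjecture, given Markman's fourfold theorem.** [cite: Markman2025SurveySecant, Thm. 1.2]
[cite: MoonenZarhin1999LowDim, Thms. (0.1)–(0.2)] -/
theorem hodgeConjectureFor_powSucc_of_mtRank_hodge_one_le_four_of_markman' {X : AbelianVariety ℂ} {n : ℕ}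
    (hX : IsSmoothProjective n X.X) (hW4 : Markman2025_weilClasses_algebraic_abelianFourfold) (h0 : 0 < X.dim)
    (h4 : haveI := BettiUniverse.finite hX 1
      @HodgeStructure.mtRank _ _ _ hodgeTensorFacts_holds.{0, 0} _ _
        (BettiUniverse.hodge exists_isReal_hodgeModel_holds hX 1) ≤ 4) (N : ℕ) :
    HodgeConjectureFor (X.powSucc N).dim (X.powSucc N).X := by
  haveI : HodgeTensorFacts.{0, 0} := hodgeTensorFacts_holds.{0, 0}
  exact hodgeConjectureFor_powSucc_of_mtRank_hodge_one_le_four_of_markman hX hW4 h0 h4 N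

end InstanceFree

section ClassTargets

open Summit.HodgeConjecture.HodgeConjecture.Ring2.ClassTargets (HCOnClass)

/-- **Class-target display**: GIVEN Markman's fourfold theorem, the Hodge conjecture holds on the class of complex abelian
varieties `B` with `0 < dim B` and `dim MT(H¹(B)) ≤ 4` (no CM hypothesis; the dependence on Markman is confined to the two
degenerate CM shapes). [cite: Markman2025SurveySecant, Thm. 1.2] [cite: Gordon1999HodgeAVSurvey, 5.13, 7.5 and 10.10]
[cite: Deligne2000, §1] -/
theorem hcOnClass_mtRank_hodge_one_le_four_of_markman (hW4 : Markman2025_weilClasses_algebraic_abelianFourfold) :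
    HCOnClass fun B => 0 < B.dim ∧
      @HodgeStructure.mtRank _ _ _ hodgeTensorFacts_holds.{0, 0}
          (BettiUniverse.finite (AbelianVariety.isSmoothProjective_holds (A := B)) 1) _
          (BettiUniverse.hodge exists_isReal_hodgeModel_holds (AbelianVariety.isSmoothProjective_holds (A := B)) 1) ≤ 4 :=
  fun _ ⟨h0, h4⟩ =>
    hodgeConjectureFor_powSucc_of_mtRank_hodge_one_le_four_of_markman' AbelianVariety.isSmoothProjective_holds hW4 h0 h4 0

end ClassTargets

end Summit.HodgeConjecture.CorCM

end
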